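/-
Copyright: the b2b-balaban T⁴-continuum CRUX team, row NE7b OWNER lineage `t4-ne7b-p1` (gen 138). Project licence.
-/
import Mathlib.Topology.MetricSpace.Contracting
import Mathlib.Algebra.Order.Field.GeomSum
import Mathlib.Tactic.Linarith
import Mathlib.Tactic.Positivity
import Mathlib.Tactic.Ring
import Mathlib.Tactic.FieldSimp

/-!
# THE RENORMALISATION CONDITION WITH FEEDBACK: a relevant coupling whose source DEPENDS ON THE COUPLING, `x_{k+1} = l·(x_k + δ_k(x_k))`
# (`l > 1`; `|δ_k(x)| ≤ D` for all `x`; `δ_k` Lipschitz with constant `K < 1`), can be TUNED to any target `x_N = a` at any horizon `N`: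
# the backward step `y ↦` (the `x` with `l(x + δ_k(x)) = y`) is the fixed point of the `K`-contraction `x ↦ y∕l − δ_k(x)`, so the tuned
# trajectory EXISTS (Banach), is UNIQUE on `[0, N]`, and — with no Lipschitz hypothesis at all — every trajectory hitting `x_N = a` obeys
# `|x_k| ≤ l^{−(N−k)}|a| + D·Σ_{i<N−k} l^{−i} ≤ |a| + D·l∕(l−1)` for `k ≤ N`, UNIFORMLY IN THE HORIZON: (434)'s given-source mechanism
# upgraded to Markovian feedback — the form in which a mass counterterm is actually fixed (SCOPING (d10); row NE7b, node U5c; Mathlib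
# only; [folklore] backward induction + Banach's fixed point on `ℝ`)

Cell `pub-balaban`, sub-cell `t4`, spine estimate NE7b (`T4WeightBudget.RelWeightBound`; the cell's OWN estimate — NOT PRINTED in
[Bałaban 1983–89], NOT PROVED).  Crux-route work under `Spine/NE7b/` by the row OWNER (`t4-ne7b-p1` gen 138, file (435)) under FREEZE
(0)'s crux-prover clause; NOTHING of Bałaban's is named as a Lean object, valued or asserted; no `T4Continuum/Support` leaf typed; no
`def`, no notation; zero `sorry`.  Imports: Mathlib only (fast lane); (434) `…SupRelevantDirectionTuning` (given sources) is met BY SHAPE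
(its recursion is the case `δ_k(x) = δ_k`), not imported.

WHY ((434) HONEST: «the real flow feeds the coupling back into its sources»).  In one renormalisation step the deposit into a relevant
coupling (the local quadratic part of the fluctuation output, (427)'s `K_D`) depends on the current couplings; in the one-coupling
truncation this is `δ_k(x_k)`, small and Lipschitz-small in the coupling.  The renormalisation condition «`x_N = a` at the final scale»
must then be SOLVED, not just evaluated: backwards from the horizon each step asks for the `x` with `l(x + δ_k(x)) = y`, i.e. the fixed
point of `x ↦ y∕l − δ_k(x)`, a `K`-contraction of `ℝ` — unique solution (§1), hence a unique tuned trajectory (§3, §4); and the a-priori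
bound (§2) needs only `|δ_k| ≤ D`: backwards the expanding map divides by `l`, so the deposits are summed with the CONVERGENT weights
`l^{−i}` — the counterterm is finite and the trajectory bounded uniformly in `N`, which is what «renormalisable relevant direction» means.

WHAT IS PROVED ([folklore]; `l D : ℝ`, `K : ℝ≥0`, `δ : ℕ → ℝ → ℝ`, trajectories `x x′ : ℕ → ℝ`):
* §1 THE BACKWARD STEP: `backward_contracting` (`K < 1`, `δ_k` `K`-Lipschitz ⟹ `x ↦ y∕l − δ_k(x)` is `ContractingWith K`), `backward_step_solves`
  (its fixed point `x⋆` satisfies `l(x⋆ + δ_k(x⋆)) = y`, `l ≠ 0`), `backward_step_unique` (two solutions of `l(x + δ_k(x)) = y` coincide).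
* §2 **`feedback_tuned_bound`** (NO Lipschitz hypothesis: `l > 1`, `|δ_k(x)| ≤ D`, `x_N = a`, the recursion for `k < N` ⟹ for `k + m = N`:
  `|x_k| ≤ l^{−m}|a| + D·Σ_{i<m} l^{−i}`), **`feedback_tuned_bound_uniform`** (`⟹ |x_k| ≤ |a| + D·l∕(l−1)` for all `k ≤ N`).
* §3 **`feedback_tuned_unique`** (two trajectories with the recursion for `k < N` and the same `x_N` agree on `[0, N]`).
* §4 **`feedback_tuned_exists`** (`∃ x`, `x_N = a` and the recursion for all `k < N` — backward Banach iteration).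
* §5 toy (kernel): zero feedback, `l = 2`, `N = 0`: the bound reads `|x_0| ≤ |a|`.

HONEST (what this is NOT).  One coupling, Markovian feedback `δ_k(x_k)`; the deposit of a real step depends on ALL current data (the other
couplings and the irrelevant remainder), i.e. a triangular∕coupled system whose off-diagonal Lipschitz constants must be small — the
multi-coupling stable-manifold statement is the diagonal-dominant version of §1–§4 and is NOT typed; the marginal coupling (`l = 1`) is
NOT covered (β-function, the β-flow team's B12 Thm 2); nothing here produces `D`, `K` for Bałaban's steps.  Nothing of Bałaban's
asserted; BY-NAME EFFECT ON THE WALL: NONE.  NE7b NOT PRINTED ∕ NOT PROVED; spine PROVED 0∕9; rung (B)+1 — the programme's measures remain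
FINITE-torus statements; NOT the mass gap, NOT Clay.  HONEST DEPENDENCY: continuum YM on T⁴ ⇐ BetaPertH ∧ nine spine estimates (0∕9
proved); BetaPertH ⇐ (D1) ∧ (D4) ∧ CAP+tail; G-an2-4 gates asym, D1 and NE2∕3∕4.
-/

set_option autoImplicit false

namespace Summit.QuantumFields.BalabanUV.T4Continuum.NE7b.SupRelevantDirectionFeedback

open Finset Function
open scoped BigOperators NNReal

variable {x x' : ℕ → ℝ} {δ : ℕ → ℝ → ℝ} {l D : ℝ} {K : ℝ≥0}

/-! ## §1. The backward step is a contraction -/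

/-- **THE BACKWARD STEP IS A `K`-CONTRACTION**: `δ_k` `K`-Lipschitz with `K < 1` makes `x ↦ y∕l − δ_k(x)` contracting. [folklore] -/
theorem backward_contracting (hK : K < 1) (hδL : ∀ k, LipschitzWith K (δ k)) (k : ℕ) (y : ℝ) :
    ContractingWith K (fun x : ℝ => y / l - δ k x) := by
  refine ⟨hK, LipschitzWith.of_dist_le_mul fun a b => ?_⟩
  have h := (hδL k).dist_le_mul a b
  rw [Real.dist_eq] at h ⊢
  calc |y / l - δ k a - (y / l - δ k b)| = |δ k b - δ k a| := by congr 1; ring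
    _ = |δ k a - δ k b| := abs_sub_comm _ _
    _ ≤ K * |a - b| := h

/-- **ITS FIXED POINT SOLVES THE BACKWARD EQUATION**: the fixed point `x⋆` of `x ↦ y∕l − δ_k(x)` satisfies `l·(x⋆ + δ_k(x⋆)) = y` (`l ≠ 0`). [folklore] -/
theorem backward_step_solves (hl : l ≠ 0) (hK : K < 1) (hδL : ∀ k, LipschitzWith K (δ k)) (k : ℕ) (y : ℝ) :
    l * (ContractingWith.fixedPoint (fun x : ℝ => y / l - δ k x) (backward_contracting hK hδL k y) +
        δ k (ContractingWith.fixedPoint (fun x : ℝ => y / l - δ k x) (backward_contracting hK hδL k y))) = y := by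
  have hfp := (backward_contracting (l := l) hK hδL k y).fixedPoint_isFixedPt
  rw [IsFixedPt] at hfp
  -- `hfp : y / l - δ k x⋆ = x⋆`
  have h1 : ContractingWith.fixedPoint (fun x : ℝ => y / l - δ k x) (backward_contracting hK hδL k y) +
      δ k (ContractingWith.fixedPoint (fun x : ℝ => y / l - δ k x) (backward_contracting hK hδL k y)) = y / l := by linarith
  rw [h1]
  field_simp

/-- **THE BACKWARD EQUATION HAS AT MOST ONE SOLUTION**: `l(x + δ_k(x)) = l(x′ + δ_k(x′))`, `l ≠ 0`, `δ_k` `K`-Lipschitz with `K < 1 ⟹ x = x′`. [folklore] -/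
theorem backward_step_unique (hl : l ≠ 0) (hK : K < 1) (hδL : ∀ k, LipschitzWith K (δ k)) (k : ℕ) {u v : ℝ}
    (h : l * (u + δ k u) = l * (v + δ k v)) : u = v := by
  have h1 : u + δ k u = v + δ k v := mul_left_cancel₀ hl h
  have h2 : |u - v| ≤ K * |u - v| := by
    have hd := (hδL k).dist_le_mul v u
    rw [Real.dist_eq, Real.dist_eq] at hd
    have : u - v = δ k v - δ k u := by linarith
    calc |u - v| = |δ k v - δ k u| := by rw [this]
      _ ≤ K * |v - u| := hd
      _ = K * |u - v| := by rw [abs_sub_comm]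
  have hK' : (K : ℝ) < 1 := by exact_mod_cast hK
  have h3 : (1 - K) * |u - v| ≤ (1 - K) * 0 := by nlinarith [abs_nonneg (u - v)]
  have h4 : |u - v| ≤ 0 := le_of_mul_le_mul_left h3 (by linarith)
  exact sub_eq_zero.1 (abs_nonpos_iff.1 h4)

/-! ## §2. The a-priori bound, uniform in the horizon (no Lipschitz hypothesis) -/

/-- **THE TUNED TRAJECTORY IS BOUNDED BACKWARDS FROM THE HORIZON**: `l > 1`, `|δ_k(x)| ≤ D` for all `k, x`, the recursion for `k < N` and
`x_N = a` give, for `k + m = N`: `|x_k| ≤ l^{−m}|a| + D·Σ_{i<m} l^{−i}`. [folklore] -/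
theorem feedback_tuned_bound (hl : 1 < l) (hD : ∀ k y, |δ k y| ≤ D) {N : ℕ} {a : ℝ} (hN : x N = a)
    (hrec : ∀ k, k < N → x (k + 1) = l * (x k + δ k (x k))) :
    ∀ m k : ℕ, k + m = N → |x k| ≤ (l⁻¹) ^ m * |a| + D * ∑ i ∈ Finset.range m, (l⁻¹) ^ i := by
  have hl0 : 0 < l := by linarith
  have hr0 : 0 ≤ l⁻¹ := by positivity
  intro m
  induction m with
  | zero =>
    intro k hk
    rw [add_zero] at hk
    subst hk
    simp [hN]
  | succ m ih =>
    intro k hk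
    have hkN : k < N := by omega
    have ih' := ih (k + 1) (by omega)
    -- backward step: `x_k = x_{k+1}/l − δ_k(x_k)`
    have hstep : x k = x (k + 1) / l - δ k (x k) := by
      have h := hrec k hkN
      field_simp
      linarith
    rw [hstep]
    calc |x (k + 1) / l - δ k (x k)| ≤ |x (k + 1) / l| + |δ k (x k)| := abs_sub _ _
      _ = l⁻¹ * |x (k + 1)| + |δ k (x k)| := by rw [abs_div, abs_of_pos hl0, div_eq_inv_mul]
      _ ≤ l⁻¹ * ((l⁻¹) ^ m * |a| + D * ∑ i ∈ Finset.range m, (l⁻¹) ^ i) + D := add_le_add (mul_le_mul_of_nonneg_left ih' hr0) (hD _ _)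
      _ = (l⁻¹) ^ (m + 1) * |a| + D * ∑ i ∈ Finset.range (m + 1), (l⁻¹) ^ i := by
          have hs : ∑ i ∈ Finset.range (m + 1), (l⁻¹) ^ i = 1 + l⁻¹ * ∑ i ∈ Finset.range m, (l⁻¹) ^ i := by
            rw [Finset.sum_range_succ', pow_zero, add_comm, Finset.mul_sum]
            congr 1
            exact Finset.sum_congr rfl fun i _ => by rw [pow_succ, mul_comm]
          rw [hs, pow_succ]
          ring

/-- **UNIFORMLY IN THE HORIZON**: under the same hypotheses `|x_k| ≤ |a| + D·l∕(l−1)` for every `k ≤ N`. [folklore] -/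
theorem feedback_tuned_bound_uniform (hl : 1 < l) (hD : ∀ k y, |δ k y| ≤ D) {N : ℕ} {a : ℝ} (hN : x N = a)
    (hrec : ∀ k, k < N → x (k + 1) = l * (x k + δ k (x k))) : ∀ k, k ≤ N → |x k| ≤ |a| + D * (l / (l - 1)) := by
  intro k hk
  have hl0 : 0 < l := by linarith
  have hr0 : 0 ≤ l⁻¹ := by positivity
  have hr1 : l⁻¹ < 1 := inv_lt_one_of_one_lt₀ hl
  have hD0 : 0 ≤ D := (abs_nonneg _).trans (hD 0 0)
  obtain ⟨m, rfl⟩ := Nat.exists_eq_add_of_le hk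
  have h := feedback_tuned_bound hl hD hN hrec m k rfl
  have h1 : (l⁻¹) ^ m * |a| ≤ |a| := mul_le_of_le_one_left (abs_nonneg a) (pow_le_one₀ hr0 hr1.le)
  have h2 : ∑ i ∈ Finset.range m, (l⁻¹) ^ i ≤ l / (l - 1) := by
    have hg := geom_sum_Ico_le_of_lt_one hr0 hr1 (m := 0) (n := m)
    rw [pow_zero, ← Finset.range_eq_Ico] at hg
    have he : (1 : ℝ) / (1 - l⁻¹) = l / (l - 1) := by
      field_simp
    linarith [he]
  calc |x k| ≤ (l⁻¹) ^ m * |a| + D * ∑ i ∈ Finset.range m, (l⁻¹) ^ i := h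
    _ ≤ |a| + D * (l / (l - 1)) := add_le_add h1 (mul_le_mul_of_nonneg_left h2 hD0)

/-! ## §3. Uniqueness of the tuned trajectory -/

/-- **TWO TUNED TRAJECTORIES AGREE UP TO THE HORIZON**: the recursion for `k < N` with `K`-Lipschitz feedback (`K < 1`, `l ≠ 0`) and the
same final value `x_N = x′_N` force `x_k = x′_k` for all `k ≤ N`. [folklore] -/
theorem feedback_tuned_unique (hl : l ≠ 0) (hK : K < 1) (hδL : ∀ k, LipschitzWith K (δ k)) {N : ℕ} (hN : x N = x' N)
    (hrec : ∀ k, k < N → x (k + 1) = l * (x k + δ k (x k))) (hrec' : ∀ k, k < N → x' (k + 1) = l * (x' k + δ k (x' k))) :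
    ∀ k, k ≤ N → x k = x' k := by
  have key : ∀ m k : ℕ, k + m = N → x k = x' k := by
    intro m
    induction m with
    | zero =>
      intro k hk
      rw [add_zero] at hk
      subst hk
      exact hN
    | succ m ih =>
      intro k hk
      have hkN : k < N := by omega
      have ih' := ih (k + 1) (by omega)
      have h : l * (x k + δ k (x k)) = l * (x' k + δ k (x' k)) := by rw [← hrec k hkN, ← hrec' k hkN, ih']
      exact backward_step_unique hl hK hδL k h
  intro k hk
  obtain ⟨m, rfl⟩ := Nat.exists_eq_add_of_le hk
  exact key m k rfl

/-! ## §4. Existence of the tuned trajectory (backward Banach iteration) -/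

/-- **THE RENORMALISATION CONDITION IS SOLVABLE**: for `l ≠ 0`, `K`-Lipschitz feedback with `K < 1`, every horizon `N` and target `a`
there is a trajectory with `x_N = a` obeying `x_{k+1} = l(x_k + δ_k(x_k))` for all `k < N` (built backwards, each step the fixed point of
§1's contraction). [folklore] -/
theorem feedback_tuned_exists (hl : l ≠ 0) (hK : K < 1) (hδL : ∀ k, LipschitzWith K (δ k)) (N : ℕ) (a : ℝ) :
    ∃ x : ℕ → ℝ, x N = a ∧ ∀ k, k < N → x (k + 1) = l * (x k + δ k (x k)) := by
  -- the backward sequence `w i = x_{N-i}`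
  let w : ℕ → ℝ := fun i => Nat.rec (motive := fun _ => ℝ) a
    (fun i z => ContractingWith.fixedPoint (fun x : ℝ => z / l - δ (N - 1 - i) x) (backward_contracting hK hδL (N - 1 - i) z)) i
  have hw0 : w 0 = a := rfl
  have hwsucc : ∀ i, l * (w (i + 1) + δ (N - 1 - i) (w (i + 1))) = w i := fun i =>
    backward_step_solves hl hK hδL (N - 1 - i) (w i)
  refine ⟨fun k => w (N - k), ?_, ?_⟩
  · show w (N - N) = a
    rw [Nat.sub_self]
    exact hw0
  · intro k hk
    show w (N - (k + 1)) = l * (w (N - k) + δ k (w (N - k)))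
    have h1 : N - k = (N - (k + 1)) + 1 := by omega
    have h2 : N - 1 - (N - (k + 1)) = k := by omega
    have h := hwsucc (N - (k + 1))
    rw [h2, ← h1] at h
    exact h.symm

/-! ## §5. Toy -/

/-- Toy (kernel): with zero feedback, `l = 2`, horizon `N = 0` and target `a`, the bound of §2 reads `|x_0| ≤ |a| + 0`. -/
example (a : ℝ) (hx : x 0 = a) : |x 0| ≤ (2⁻¹ : ℝ) ^ 0 * |a| + 0 * ∑ i ∈ Finset.range 0, (2⁻¹ : ℝ) ^ i :=
  feedback_tuned_bound (δ := fun _ _ => 0) (l := 2) (by norm_num) (fun _ _ => by simp) hx (fun k hk => absurd hk (Nat.not_lt_zero k)) 0 0 rfl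

end Summit.QuantumFields.BalabanUV.T4Continuum.NE7b.SupRelevantDirectionFeedback
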